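import Literature.MathematicalPhysics.QuantumFieldTheory.Balaban1983to89.B9Thm311Curv2Symm

/-!
# `Balaban1983to89.B9Thm311SymmAtRecordV4` — row 17 of the N06 knit ([B9] Theorem 3.11) AT def-Y's v4 LETTERS OF RECORD (inverse-symmetric site
# transporter `parSymY`): the clauses «Δ′_a(U) symmetric», «Q′\* = (Q′)\*», «Q′\* injective», «G(U) symmetric» are THEOREMS; row 17 from the pin and
# FIVE displayed clauses; the U = 1 witness re-keyed (located finding R7 closed on the consumer side)

T. Bałaban, *Propagators for lattice gauge theories in a background field*, Commun. Math. Phys. **99** (1985) 389–434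
[`Balaban1985BackgroundPropagators`, "B9"]; [3] = *Propagators … I* [`Balaban1984PropagatorsI`]; [4] = *Propagators … II* [`Balaban1984PropagatorsII`].

statement-level skeleton of published theorems with citation tags; proofs where landed; nothing here is a claim about the
Yang–Mills mass gap

THE PRINTED LOCUS (verbatim, p. 416): *"Theorem 3.11. Under the assumptions of the Theorems 3.1–3.10 … the operators Δ′_a, G′, (Q′G′²Q′\*)⁻¹, Δ_a, G are
positive definite. This is obvious for the first three operators … hence it is enough to prove it for G. It is a symmetric and invertible operator …"*

WHY THIS FILE.  def-Y's v4 record (`Node00.OpsYRecordV4`: `lettersYOfRecordV4 N θ M⋆ 𝔯`, `parS = parSymY` inverse-symmetric and `G`-valued, `parB = parBY`,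
`Gp = GpY _ parSymY`, `GA = GAY _ parSymY parBY (GpY _ parSymY)` — all by `rfl`) repairs located finding R7.  At these letters, under (3.35) («U is
SU(N)-valued», `SU(N) ≤ U(N)`), four of the nine printed-shape clauses of the row-17 schema `B9Thm311ReadingAtLetters.Inputs311Y` are THEOREMS:
`symm0` (C4 `deltaPrimeAY_isSymmTr_of_inv_symm`), `adj` (C3 `isAdjTr_QpY_QpsY_of_mem`), `qps_inj` (C3 `qpsY_injective`), `symmG` (C8 `GAY_isSymmTr` — the
(3.8)∕(3.9)∕(3.13) adjoint pairs, the Jordan and commutator parts of (3.10), the (3.25) projection).  What Theorem 3.11's printed proof still takes as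
INPUT at the record is exactly print's *"Under the assumptions of the Theorems 3.1–3.10"*: `pos0` (Δ′_a(U) > 0, p. 394∕Thm 3.1), `unitA` (Δ_a(U) invertible,
Thm 3.3), and Theorem 3.10's parametrix letters G₀, R with `posG0 ∕ fac ∕ small` ((3.87), (3.105)–(3.106), GAPS G-B9-06).

* §1 at an index with `parSymY ∕ parBY`: `symm0_parSymY`, `adj_parSymY`, ★ `symmG_parSymY`.
* §2 ★ `Inputs311Y₅` (pos0 unitA posG0 fac small), ★★ `inputs311Y_of_five` (the nine-clause schema from five at letters pinned to `parSymY ∕ parBY ∕ GpY ∕ GAY`).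
* §3 ★★ `t311_of_pins_opsYOfLettersV4`, ★★★ `t311_of_pins_opsYOfRecordV4₅` ∕ `t311_of_pins_opsYOfRecordV4E₅` (row 17 at the v4 instances from `hPD` + FIVE clauses).
* §4 `proofLettersOneV4`, ★ `inputs311Y₅_lettersYOfRecordV4_one` (the five clauses jointly at `U = 1` — A4 probe), `inputs311Y_lettersYOfRecordV4_one` (all nine).

HONEST SCOPE.  Nothing of [B9] is asserted; the five displayed clauses are printed-shape hypotheses about def-Y's GENUINE v4 operators; NOT a node
discharge, NOT summit progress; count-neutral; nothing continuum, nothing about the mass gap.  Cell `pub-ymgap` (HUMAN RULING D-0062), Track A node N06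
[B9], seat `pub-ymgap-dag-n06-j` (harness re-seat gen 6), 2026-08-27.
-/

namespace Literature.MathematicalPhysics.QuantumFieldTheory.Balaban1983to89.B9Thm311SymmAtRecordV4

open Literature.MathematicalPhysics.QuantumFieldTheory.Balaban1983to89
open B9Thm311Whole B9Thm311ReadingCoords B9Thm311ReadingAtLetters B9Thm311AdjointAtLetters B9Thm311DeltaPrimeSymm B9Thm311InputsAtOne
  B9Thm311AdjointPairs B9Thm311Curv2Symm Node00
open B6KLevelCensusIndexV1 B9PinMembersKLevelV1 B9PinGeometryKLevelV1 B7Prop2SpecialUnitary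
open scoped Matrix

noncomputable section

/-! ## §1 At an index: the four clauses that are theorems over `parSymY ∕ parBY` -/

section Index

open scoped Matrix.Norms.L2Operator

variable {d ℓ : ℕ} {hd : 1 ≤ d + 1} {hL : Odd (ℓ + 1) ∧ 1 < ℓ + 1} {b₀ b₁ : ℝ} {N : ℕ}
variable (i : KIdx d ℓ hd hL b₀ b₁) {G : Subgroup (Matrix (Fin N) (Fin N) ℂ)ˣ}

/-- `symm0` at `parSymY`: Δ′_a(U) is symmetric for a `G`-valued configuration, `G ≤ U(N)`. [cite: Balaban1985BackgroundPropagators, (3.24) p.394, Thm 3.11 p.416] -/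
theorem symm0_parSymY (hG : G ≤ B7Prop2Explicit.unitaryUnits (Matrix (Fin N) (Fin N) ℂ)) {U : CfgY (Matrix (Fin N) (Fin N) ℂ) i}
    (hU : ∀ μ x, U μ x ∈ G) : IsSymmTr (fun _ => (1 : ℝ)) (deltaPrimeAY i (parSymY i) U) :=
  deltaPrimeAY_isSymmTr_of_inv_symm i hG (parSymY i) U (parSymY_inv_symm U) (fun z w => parSymY_mem i hU z w) hU

/-- `adj` at `parSymY`: Q′\*(U) is the `W`-adjoint of Q′(U). [cite: Balaban1985BackgroundPropagators, p.393; Balaban1984PropagatorsII, (2.69) p.235] -/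
theorem adj_parSymY (hG : G ≤ B7Prop2Explicit.unitaryUnits (Matrix (Fin N) (Fin N) ℂ)) {U : CfgY (Matrix (Fin N) (Fin N) ℂ) i}
    (hU : ∀ μ x, U μ x ∈ G) : IsAdjTr (fun _ => (1 : ℝ)) (wB i) (QpY i (parSymY i) U) (QpsY i (parSymY i) U) :=
  isAdjTr_QpY_QpsY_of_mem i hG (parSymY i) U fun z w => parSymY_mem i hU z w

/-- ★ `symmG` at `parSymY ∕ parBY`: `G(U) = Δ_a(U)⁻¹` (def-Y's `GAv4Y`) is symmetric (print: *"It is a symmetric … operator"*).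
[cite: Balaban1985BackgroundPropagators, (3.27) p.395, Thm 3.11 p.416] -/
theorem symmG_parSymY (hG : G ≤ B7Prop2Explicit.unitaryUnits (Matrix (Fin N) (Fin N) ℂ)) {U : CfgY (Matrix (Fin N) (Fin N) ℂ) i}
    (hU : ∀ μ x, U μ x ∈ G) : IsSymmTr (fun _ => (1 : ℝ)) (GAY i (parSymY i) (parBY i) (GpY i (parSymY i)) U) :=
  GAY_isSymmTr i hG (parSymY i) (parBY i) U hU (fun s s' => parBY_mem i hU s s') (symm0_parSymY i hG hU) (adj_parSymY i hG hU)

end Index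

/-! ## §2 The five-clause schema and the nine from five -/

section Schema

open scoped Matrix.Norms.L2Operator

variable {d ℓ : ℕ} {hd : 1 ≤ d + 1} {hL : Odd (ℓ + 1) ∧ 1 < ℓ + 1} {b₀ b₁ : ℝ} {Mstar : ℕ} {N : ℕ}

/-- ★ **THE FIVE REMAINING DISPLAYED INPUTS OF THEOREM 3.11 AT THE v4 LETTERS** (*"Under the assumptions of the Theorems 3.1–3.10"*): `pos0` — Δ′_a(U) positive
(p. 394 ∕ Thm 3.1); `unitA` — Δ_a(U) invertible (Thm 3.3: G exists); `posG0`, `fac`, `small` — Theorem 3.10's parametrix letters G₀, R: G₀ positive, G₀ = G(I − R)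
((3.105)–(3.106)), ⟨Ψ, RΨ⟩ ≦ θ₁M⁻¹⟨Ψ, Ψ⟩ (GAPS G-B9-06).  Nothing asserted. [cite: Balaban1985BackgroundPropagators, Thm 3.11 proof p.416 + (3.24) p.394 + (3.105)–(3.106) p.414] -/
structure Inputs311Y₅ (x : MemberY d ℓ hd hL b₀ b₁ Mstar) (𝔏 : CovLettersY (Matrix (Fin N) (Fin N) ℂ) x) (𝔔 : ProofLetters311 N x.toKIdx)
    (θ₁ M : ℝ) (U : CfgY (Matrix (Fin N) (Fin N) ℂ) x.toKIdx) : Prop where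
  pos0 : PosDefTr (fun _ => (1 : ℝ)) (deltaPrimeAY x.toKIdx 𝔏.parS U)
  unitA : IsUnit (deltaAY x.toKIdx 𝔏.parS 𝔏.parB 𝔏.Gp U)
  posG0 : PosDefTr (fun _ => (1 : ℝ)) (𝔔.G0 U)
  fac : 𝔔.G0 U = 𝔏.GA U ∘ₗ (1 - 𝔔.R U)
  small : ∀ Ψ : FBondY x.toKIdx → Matrix (Fin N) (Fin N) ℂ,
    trIP (fun _ => (1 : ℝ)) Ψ (𝔔.R U Ψ) ≤ θ₁ * M⁻¹ * trIP (fun _ => (1 : ℝ)) Ψ Ψ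

/-- ★★ **NINE FROM FIVE AT LETTERS PINNED TO `parSymY ∕ parBY ∕ GpY ∕ GAY`** (all `rfl` at `lettersYOfRecordV4`), for a `G`-valued configuration, `G ≤ U(N)`:
`symm0`, `adj`, `qps_inj`, `symmG` are supplied by the theorems of §1 and `B9Thm311AdjointAtLetters.qpsY_injective`.
[cite: Balaban1985BackgroundPropagators, Thm 3.11 p.416, (3.24)–(3.27) pp.394–395, (3.35) p.396; Balaban1984PropagatorsI, p.25] -/
theorem inputs311Y_of_five {G : Subgroup (Matrix (Fin N) (Fin N) ℂ)ˣ} (hG : G ≤ B7Prop2Explicit.unitaryUnits (Matrix (Fin N) (Fin N) ℂ))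
    (x : MemberY d ℓ hd hL b₀ b₁ Mstar) (𝔏 : CovLettersY (Matrix (Fin N) (Fin N) ℂ) x) (𝔔 : ProofLetters311 N x.toKIdx)
    (hparS : 𝔏.parS = parSymY x.toKIdx) (hparB : 𝔏.parB = parBY x.toKIdx) (hGp : 𝔏.Gp = GpY x.toKIdx 𝔏.parS)
    (hGA : 𝔏.GA = GAY x.toKIdx 𝔏.parS 𝔏.parB 𝔏.Gp) {θ₁ M : ℝ} {U : CfgY (Matrix (Fin N) (Fin N) ℂ) x.toKIdx} (hU : ∀ μ z, U μ z ∈ G)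
    (h : Inputs311Y₅ x 𝔏 𝔔 θ₁ M U) : Inputs311Y x 𝔏 𝔔 θ₁ M U where
  pos0 := h.pos0
  symm0 := by rw [hparS]; exact symm0_parSymY x.toKIdx hG hU
  adj := by rw [hparS]; exact adj_parSymY x.toKIdx hG hU
  qps_inj := qpsY_injective x.toKIdx 𝔏.parS U
  unitA := h.unitA
  symmG := by rw [hGA, hGp, hparS, hparB]; exact symmG_parSymY x.toKIdx hG hU
  posG0 := h.posG0
  fac := h.fac
  small := h.small

end Schema

/-! ## §3 Row 17 at the v4 letters ∕ instances of record from the pin and five clauses -/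

section StageY

open scoped Matrix.Norms.L2Operator

variable {N : ℕ} (θ : Stage3Params) (Mstar : ℕ) (𝔯 : ResY N θ Mstar) (𝔈 : ExpsY N θ Mstar)

/-- ★★ **ROW 17 AT `opsYOfLetters` OVER THE v4 LETTERS** `lettersYOfRecordV4 N θ M⋆ 𝔯`: from the pin `hPD` and the FIVE-clause schema under (3.35).
[cite: Balaban1985BackgroundPropagators, Thm 3.11 p.416 + (3.35) p.396] -/
theorem t311_of_pins_opsYOfLettersV4 (𝔔 : ∀ x : MemberY θ.d₆ θ.ℓ₆ θ.hd' θ.hL' θ.b₀ θ.b₁ Mstar, ProofLetters311 N x.toKIdx)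
    (θ₁ a₁ M₁ : ℝ) (ha₁ : 0 < a₁) (hM₁ : 0 < M₁)
    (h311 : ∀ x : MemberY θ.d₆ θ.ℓ₆ θ.hd' θ.hL' θ.b₀ θ.b₁ Mstar, M₁ ≤ (geo9Y x).M → ∀ α₀ : ℝ, 0 < α₀ → (geo9Y x).M * α₀ ≤ a₁ →
      ∀ U : (bg9Y (Matrix (Fin N) (Fin N) ℂ) (specialUnitaryUnits (Fin N)) x).Cfg,
        (bg9Y (Matrix (Fin N) (Fin N) ℂ) (specialUnitaryUnits (Fin N)) x).Reg335 c35Y α₀ U →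
          Inputs311Y₅ x (lettersYOfRecordV4 N θ Mstar 𝔯 x) (𝔔 x) θ₁ (geo9Y x).M U)
    (hPD : ∀ x : MemberY θ.d₆ θ.ℓ₆ θ.hd' θ.hL' θ.b₀ θ.b₁ Mstar,
      ((opsYOfLetters N θ Mstar (lettersYOfRecordV4 N θ Mstar 𝔯) 𝔈) x).PosDef = PosDefOfOps (ops311Y x (lettersYOfRecordV4 N θ Mstar 𝔯 x) (𝔔 x))) :
    B9.Thm311Printed c35Y geo9Y (bg9Y (Matrix (Fin N) (Fin N) ℂ) (specialUnitaryUnits (Fin N)))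
      (fun x => ((opsYOfLetters N θ Mstar (lettersYOfRecordV4 N θ Mstar 𝔯) 𝔈) x).PosDef) :=
  t311_of_pins_opsYOfLetters θ Mstar (lettersYOfRecordV4 N θ Mstar 𝔯) 𝔈 𝔔 θ₁ a₁ M₁ ha₁ hM₁ (fun _ => rfl) (fun _ => rfl)
    (fun x hM α₀ hα₀ hMa U hU => inputs311Y_of_five specialUnitaryUnits_le_unitaryUnits x (lettersYOfRecordV4 N θ Mstar 𝔯 x) (𝔔 x)
      rfl rfl rfl rfl hU.1.1 (h311 x hM α₀ hα₀ hMa U hU)) hPD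

/-- ★★★ **ROW 17 AT def-Y's v4 INSTANCE `opsYOfRecordV4 N θ M⋆ 𝔯 𝔈`** from the pin and FIVE displayed clauses — `symm0`, `adj`, `qps_inj`, `symmG` and the two-sided
inverse identities are THEOREMS about the GENUINE operators. [cite: Balaban1985BackgroundPropagators, Thm 3.11 p.416 + (3.24)–(3.27) pp.394–395 + (3.35) p.396] -/
theorem t311_of_pins_opsYOfRecordV4₅ (𝔔 : ∀ x : MemberY θ.d₆ θ.ℓ₆ θ.hd' θ.hL' θ.b₀ θ.b₁ Mstar, ProofLetters311 N x.toKIdx)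
    (θ₁ a₁ M₁ : ℝ) (ha₁ : 0 < a₁) (hM₁ : 0 < M₁)
    (h311 : ∀ x : MemberY θ.d₆ θ.ℓ₆ θ.hd' θ.hL' θ.b₀ θ.b₁ Mstar, M₁ ≤ (geo9Y x).M → ∀ α₀ : ℝ, 0 < α₀ → (geo9Y x).M * α₀ ≤ a₁ →
      ∀ U : (bg9Y (Matrix (Fin N) (Fin N) ℂ) (specialUnitaryUnits (Fin N)) x).Cfg,
        (bg9Y (Matrix (Fin N) (Fin N) ℂ) (specialUnitaryUnits (Fin N)) x).Reg335 c35Y α₀ U →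
          Inputs311Y₅ x (lettersYOfRecordV4 N θ Mstar 𝔯 x) (𝔔 x) θ₁ (geo9Y x).M U)
    (hPD : ∀ x : MemberY θ.d₆ θ.ℓ₆ θ.hd' θ.hL' θ.b₀ θ.b₁ Mstar,
      ((opsYOfRecordV4 N θ Mstar 𝔯 𝔈) x).PosDef = PosDefOfOps (ops311Y x (lettersYOfRecordV4 N θ Mstar 𝔯 x) (𝔔 x))) :
    B9.Thm311Printed c35Y geo9Y (bg9Y (Matrix (Fin N) (Fin N) ℂ) (specialUnitaryUnits (Fin N)))
      (fun x => ((opsYOfRecordV4 N θ Mstar 𝔯 𝔈) x).PosDef) :=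
  t311_of_pins_opsYOfLettersV4 θ Mstar 𝔯 𝔈 𝔔 θ₁ a₁ M₁ ha₁ hM₁ h311 hPD

/-- ★★★ **ROW 17 AT THE FULL v4 INSTANCE `opsYOfRecordV4E N θ M⋆ 𝔯 𝔢 𝔴 𝔈`** (Sect. E layer on top; its positivity field is still `𝔈`'s, by `rfl`).
[cite: Balaban1985BackgroundPropagators, Thm 3.11 p.416 + (3.35) p.396] -/
theorem t311_of_pins_opsYOfRecordV4E₅ (𝔢 : SectEY N θ Mstar) (𝔴 : RWEY N θ Mstar)
    (𝔔 : ∀ x : MemberY θ.d₆ θ.ℓ₆ θ.hd' θ.hL' θ.b₀ θ.b₁ Mstar, ProofLetters311 N x.toKIdx)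
    (θ₁ a₁ M₁ : ℝ) (ha₁ : 0 < a₁) (hM₁ : 0 < M₁)
    (h311 : ∀ x : MemberY θ.d₆ θ.ℓ₆ θ.hd' θ.hL' θ.b₀ θ.b₁ Mstar, M₁ ≤ (geo9Y x).M → ∀ α₀ : ℝ, 0 < α₀ → (geo9Y x).M * α₀ ≤ a₁ →
      ∀ U : (bg9Y (Matrix (Fin N) (Fin N) ℂ) (specialUnitaryUnits (Fin N)) x).Cfg,
        (bg9Y (Matrix (Fin N) (Fin N) ℂ) (specialUnitaryUnits (Fin N)) x).Reg335 c35Y α₀ U →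
          Inputs311Y₅ x (lettersYOfRecordV4 N θ Mstar 𝔯 x) (𝔔 x) θ₁ (geo9Y x).M U)
    (hPD : ∀ x : MemberY θ.d₆ θ.ℓ₆ θ.hd' θ.hL' θ.b₀ θ.b₁ Mstar,
      ((opsYOfRecordV4E N θ Mstar 𝔯 𝔢 𝔴 𝔈) x).PosDef = PosDefOfOps (ops311Y x (lettersYOfRecordV4 N θ Mstar 𝔯 x) (𝔔 x))) :
    B9.Thm311Printed c35Y geo9Y (bg9Y (Matrix (Fin N) (Fin N) ℂ) (specialUnitaryUnits (Fin N)))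
      (fun x => ((opsYOfRecordV4E N θ Mstar 𝔯 𝔢 𝔴 𝔈) x).PosDef) :=
  t311_of_pins_opsYOfLettersV4 θ Mstar 𝔯 𝔈 𝔔 θ₁ a₁ M₁ ha₁ hM₁ h311 hPD

end StageY

/-! ## §4 The five clauses hold jointly at `U = 1` at the v4 letters (A4 probe) -/

section AtOne

open scoped Matrix.Norms.L2Operator

variable {N : ℕ} (θ : Stage3Params) (Mstar : ℕ) (𝔯 : ResY N θ Mstar)

/-- the witness for the parametrix letters at the v4 record: `G₀ := G(U)` (def-Y's `GAv4Y`), `R := 0`. [cite: Balaban1985BackgroundPropagators, (3.105)–(3.106) p.414, dictionary] -/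
def proofLettersOneV4 (x : MemberY θ.d₆ θ.ℓ₆ θ.hd' θ.hL' θ.b₀ θ.b₁ Mstar) : ProofLetters311 N x.toKIdx where
  G0 := fun U => (lettersYOfRecordV4 N θ Mstar 𝔯 x).GA U
  R := fun _ => 0

/-- ★ **THE FIVE DISPLAYED CLAUSES HOLD JOINTLY AT `U = 1` AT THE v4 LETTERS** (A4 probe; any `θ₁ ≥ 0`, `M ≥ 0`): Δ′_a(1) positive ([4] p.225), Δ_a(1) invertible,
G₀ := G(1) positive ([4] p.228), G₀ = G(I − 0), `0 ≤ θ₁M⁻¹⟨Ψ, Ψ⟩`. [cite: Balaban1985BackgroundPropagators, Thm 3.11 p.416, p.395 (U = 1); Balaban1984PropagatorsII, p.225, p.228] -/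
theorem inputs311Y₅_lettersYOfRecordV4_one (x : MemberY θ.d₆ θ.ℓ₆ θ.hd' θ.hL' θ.b₀ θ.b₁ Mstar) {θ₁ M : ℝ} (hθ₁ : 0 ≤ θ₁) (hM : 0 ≤ M) :
    Inputs311Y₅ x (lettersYOfRecordV4 N θ Mstar 𝔯 x) (proofLettersOneV4 θ Mstar 𝔯 x) θ₁ M (fun _ _ => 1) := by
  have hparS : ∀ z w, (lettersYOfRecordV4 N θ Mstar 𝔯 x).parS (fun _ _ => 1) z w = 1 := (lettersYOfRecordV4 N θ Mstar 𝔯 x).parS_one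
  have hparB : ∀ s s', (lettersYOfRecordV4 N θ Mstar 𝔯 x).parB (fun _ _ => 1) s s' = 1 := (lettersYOfRecordV4 N θ Mstar 𝔯 x).parB_one
  have hGp := (lettersYOfRecordV4 N θ Mstar 𝔯 x).Gp_one
  have hGA1 : (lettersYOfRecordV4 N θ Mstar 𝔯 x).GA (fun _ _ => 1) =
      liftEndY (Matrix (Fin N) (Fin N) ℂ) (B6Prop26Census2136KLevelV1.Gop x.toKIdx) := GAY_one x.toKIdx hparS hparB hGp
  refine ⟨?_, ?_, ?_, ?_, ?_⟩
  · rw [deltaPrimeAY_one x.toKIdx _ hparS]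
    exact posDefTr_liftOpY _ (dotProduct_mlOpT_mulVec_pos x.toKIdx)
  · exact isUnit_deltaAY_one x.toKIdx hparS hparB hGp
  · change PosDefTr (fun _ => (1 : ℝ)) ((lettersYOfRecordV4 N θ Mstar 𝔯 x).GA (fun _ _ => 1))
    rw [hGA1]
    exact liftEndY_posDefTr _ (dotProduct_Gop_pos x.toKIdx)
  · change (lettersYOfRecordV4 N θ Mstar 𝔯 x).GA (fun _ _ => 1) = (lettersYOfRecordV4 N θ Mstar 𝔯 x).GA (fun _ _ => 1) ∘ₗ (1 - 0)
    rw [sub_zero, Module.End.one_eq_id, LinearMap.comp_id]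
  · intro Ψ
    change trIP (fun _ => (1 : ℝ)) Ψ ((0 : (FBondY x.toKIdx → Matrix (Fin N) (Fin N) ℂ) →ₗ[ℂ] _) Ψ) ≤ _
    rw [LinearMap.zero_apply, trIP_zero_right]
    have hΨ : 0 ≤ trIP (fun _ => (1 : ℝ)) Ψ Ψ := by
      rw [← norm_sq_realify311 (hw := fun _ => one_pos)]
      exact sq_nonneg _
    exact mul_nonneg (mul_nonneg hθ₁ (inv_nonneg.2 hM)) hΨ

/-- all NINE clauses at `U = 1` at the v4 letters (the trivial configuration is `SU(N)`-valued). [cite: Balaban1985BackgroundPropagators, Thm 3.11 p.416, p.395 (U = 1)] -/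
theorem inputs311Y_lettersYOfRecordV4_one (x : MemberY θ.d₆ θ.ℓ₆ θ.hd' θ.hL' θ.b₀ θ.b₁ Mstar) {θ₁ M : ℝ} (hθ₁ : 0 ≤ θ₁) (hM : 0 ≤ M) :
    Inputs311Y x (lettersYOfRecordV4 N θ Mstar 𝔯 x) (proofLettersOneV4 θ Mstar 𝔯 x) θ₁ M (fun _ _ => 1) :=
  inputs311Y_of_five specialUnitaryUnits_le_unitaryUnits x (lettersYOfRecordV4 N θ Mstar 𝔯 x) (proofLettersOneV4 θ Mstar 𝔯 x) rfl rfl rfl rfl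
    (fun _ _ => (specialUnitaryUnits (Fin N)).one_mem) (inputs311Y₅_lettersYOfRecordV4_one θ Mstar 𝔯 x hθ₁ hM)

end AtOne

end

end Literature.MathematicalPhysics.QuantumFieldTheory.Balaban1983to89.B9Thm311SymmAtRecordV4
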